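import Summits.ResolutionOfSingularities.ResolutionOfSingularities.Theorems.PrincipalAxisCut
import Literature.AlgebraicGeometry.Resolution.MarkedIdealsArithmetic
import Literature.AlgebraicGeometry.Resolution.KollarStep2Stage
import HarnessLib

/-!
# PowerLift — decomp-res lens-5 («finite/base range + asymptotic regime + bridge»), generation 42

HOST TARGET BY NAME: `MaxContactCut.NoForcedTowers` (item 30253) = `∀ n ≥ 1, ForcedTowersTerminate n`; current tree root
consumer `HugValuationCut.noForcedTowers_of_g47` (Theorems/PrincipalAxisCut, lens-5 g41; ten binders `hMo hSL hH hP hM h71 hB hC4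
hD4 hNP`).  DOOR: the WEIGHT AXIS of the root — the binders `h71 : MaxContactCut.NoContactHuggingTowers` (31571), `hP :
ShadowPortAll`, `hM : MarkingPortAll`, and the root item itself.

## THE BRIDGE: THE MARKING-POWER TOWER `T ↦ T^a`

Replace every marked ideal `(𝓘_i, E_i, n)` of a forced tower `T` by its marking power `(𝓘_i^a, E_i, a·n)` (`powMarked`) and keep
EVERYTHING ELSE — stages, marked points, centres, blow-ups, boundaries (`powTower`).  This is again a forced tower because, at the
REGULAR stalks of the stages (tree `tower_isRegular`, every stage of a tower with a base root is regular),
* `supp(𝓘^a, a·n) = supp(𝓘, n)` (Literature `le_idealOrder_pow_iff`, BGMW Example 3.4.2) — the marked point stays ISOLATED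
  (`powTower_hiso`);
* the BGMW transform is multiplicative, `σᶜ(𝓘^a, a·n) = σᶜ(𝓘, n)^a` (Literature `controlledTransform_pow`, BGMW Lemma 3.7.1), fed by
  order-permissibility `𝓘_i ≤ 𝓘_{x_i}^n` (Literature `le_pow_of_isRegular_subscheme_of_forall_le_idealOrder_of_isRegular` + tree
  `tower_idealOrder_pt_eq`) — the transform law persists (`powTower_htr`);
* the root data transport: `IsBase` verbatim, `IsDatum (a·n)` (Literature `idealOrder_pow_eq`), boundary `[]` verbatim.

## CONSEQUENCE (§3): TERMINATING WEIGHTS OF A GEOMETRIC CLASS ARE DIVISOR-CLOSED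

For every MARKING-FREE tower class `P` (`PowStable P`: the letter of `P` reads only stages / points / centres / blow-ups /
boundaries — `ContactHugging`, `GermHugging`, `Hugs`, `CurveHugging`, `SurfaceHugging`, `RegularSurfaceHugging`, `ThreefoldTower`,
existence of hug shadows and of marked shadows, §4):

    `NoTower (a·n) P → NoTower n P`   (`a ≥ 1`; `noTower_of_noTower_mul`),

hence with `a = p^J`:  `(∀ n ≥ 1, NoTower n P) ⟺ (∀ n ≥ 1, NoTowerDeep J n P)` for EVERY `J` (`noTower_all_iff_deep`), where
`NoTowerDeep J n P` is the column `p^J ∣ n` (`NoTowerDeep 1 = NoTowerWild` of g21's weight axis, `NoTowerDeep 0 = NoTower`).  The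
TAME column (`p ∤ n`; g21's `NoTowerTameSep ∧ NoTowerTameInsep`, ANY field) and every bounded-`v_p(n)` range of such a class are
REDUNDANT, hypothesis-free and port-free; only `v_p(n) → ∞` carries the problem (base range ↦ asymptotic regime, bridge `T ↦ T^{p^J}`).

## BY NAME (§5)

EXACT, hypothesis-free: `MaxContactCut.NoForcedTowers ⟺ NoForcedTowersAtWildWeights ⟺ ∀ n ≥ 1, NoTowerDeep J n ⊤` (30253, every
`J`); `MaxContactCut.NoContactHuggingTowers ⟺ NoContactHuggingTowersAtWildWeights` (31571); 31570, 31572 likewise; `ShadowPortAll ⟺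
ShadowPortAtWildWeights`, `MarkingPortAll ⟺ MarkingPortAtWildWeights` (hug shadows transport field by field; marked sequences are
REWEIGHTED, `f_i := F_i · (∏_{j<i} z_j)^{b·n}` turns weight `(b+1)·n` into weight `n`; off-locus transports because the germ ideal
of a hug shadow is PRIME — its quotient is pinned to a subring of a field).  EXACT MODULO THE MONOMIAL PORT `hMo` (§3b, the
RELATIVE bridge: the letter `EventuallyMonomial` reads the marking and is DISPATCHED, not transported — the marking power of a
never-monomial tower is either killed by the monomial class `monomial_of_ports hMo noCornerTowers_tree` or lies in the same
never-monomial column at weight `a·n`): `MaxContactCut.NoHypersurfaceHuggingTowers ⟺ NoHypersurfaceHuggingTowersAtWildWeights` (the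
binder `hH`), and the never-monomial leaves `SurfaceHuggingTowersTerminate` (w = 2), `NonMonomialContactTowersTerminate`,
`NonMonomialWildTowersTerminate` likewise.  ROOT CONSUMERS: `noForcedTowers_of_g49` = the tree root `noForcedTowers_of_g47` with
`hP hM h71` restricted to the weights divisible by `p`; `noForcedTowers_of_g49h` with `hH` restricted as well (FOUR of the ten
binders WEAKER by letter, EQUIVALENT by the bridge; `hMo hSL hB hC4 hD4 hNP` verbatim).

## HONEST SCOPE

Untouched binders: `hMo` (the port itself), `hSL` (being shed by lens-4 g46 «SubmaximalCut» through `h71`; composing the two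
roots is one line), `hB hC4 hD4` (ALREADY wild-weight columns `NoTowerWild`, and their letter `MixedResidual n` reads the
marking), `hNP` (its letters `SingularClass`, `InLocusShadow`, `¬ Principal` fit §3b/§4, but `ContactFreeTower n` needs the
Leibniz inclusion `Diff^{≤ an−1}_ℤ(𝓘^a) ⊆ Σ Diff^{≤ i}_ℤ(𝓘)⋯` on a regular STALK over an arbitrary field — Literature
`diffIdeal_mul_le_of_smooth` is for smooth algebras over a field `K` and `K`-operators; the `p`-th marking power of a TAME
CONTACT tower IS absolutely contact-free (`Diff^{≤ p−1}(x^p) = (x^p)`), so the latency letters are NOT marking-invariant, only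
conjecturally monotone).  Submaximality (g46) is not marking-free either (`𝓘^a ⊆ 𝔭^{a(n-1)} ⊄ 𝔭^{an-1}`).  NO conjunct of
30253 is proved here and no cell is DECIDED: the node is a MAP (an exact, weight-changing self-map of `ForcedTower`, the
first in the tree) and its census consequence (the TAME coordinate of every marking-free column, and — modulo `hMo` — of
every never-monomial marking-free column, is struck: it is implied by the wild coordinate one level up, `T ↦ T^p`).

(Sources: BierstoneGrigorievMilmanWlodarczyk2011 Example 3.4.2, Lemma 3.7.1, Lemma 3.2.1; Kollar2007 3.30.2, 3.57; ZariskiSamuel1960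
VIII §1; Villamayor1989 (constructiveness: equivalent basic objects / idealistic pairs); Hironaka1964 (idealistic exponents `(J, b) ∼ (J^e, eb)`).)
-/

noncomputable section

set_option linter.dupNamespace false

open CategoryTheory CategoryTheory.Limits AlgebraicGeometry TopologicalSpace IsLocalRing
open Literature.AlgebraicGeometry.Resolution
open Summit.ResolutionOfSingularities.ResolutionOfSingularities.Theorems
open WeakOrderReduction ForcedTowerClasses DivergentTowerClasses MonomialTowerClasses
open HugDimensionClasses HugDimensionKernels SurfaceShadowClasses SurfaceShadowKernels

namespace Summit.ResolutionOfSingularities.ResolutionOfSingularities.Theorems.HugValuationCut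

/-! ## §1 Marking powers of marked ideals (BGMW Example 3.4.2, Lemma 3.7.1) -/

section MarkingPower

/-- **The `a`-th MARKING POWER `(𝓘^a, E, a·μ)`** of a marked ideal `(𝓘, E, μ)` — same boundary (BGMW Example 3.4.2:
equivalent to `(𝓘, E, μ)`; Hironaka's `(J, b) ∼ (J^e, e·b)`). -/
def powMarked {X : Scheme.{0}} (M : MarkedIdeal X) (a : ℕ) : MarkedIdeal X :=
  { ideal := M.ideal ^ a, boundary := M.boundary, mult := a * M.mult }

/-- unfolding. [folklore] -/
@[simp] theorem powMarked_ideal {X : Scheme.{0}} (M : MarkedIdeal X) (a : ℕ) : (powMarked M a).ideal = M.ideal ^ a := rfl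

/-- unfolding. [folklore] -/
@[simp] theorem powMarked_boundary {X : Scheme.{0}} (M : MarkedIdeal X) (a : ℕ) :
    (powMarked M a).boundary = M.boundary := rfl

/-- unfolding. [folklore] -/
@[simp] theorem powMarked_mult {X : Scheme.{0}} (M : MarkedIdeal X) (a : ℕ) : (powMarked M a).mult = a * M.mult := rfl

/-- **`supp(𝓘^a, a·μ) = supp(𝓘, μ)` at a point with regular local ring** (`a ≥ 1`).
[cite: BierstoneGrigorievMilmanWlodarczyk2011, Example 3.4.2] -/
theorem mem_support_powMarked_iff {X : Scheme.{0}} (M : MarkedIdeal X) {a : ℕ} (ha : 0 < a) (x : X)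
    [IsRegularLocalRing (X.presheaf.stalk x)] : x ∈ (powMarked M a).support ↔ x ∈ M.support := by
  show ((a * M.mult : ℕ) : ℕ∞) ≤ idealOrder (M.ideal ^ a) x ↔ (M.mult : ℕ∞) ≤ idealOrder M.ideal x
  exact le_idealOrder_pow_iff M.ideal ha M.mult

/-- **The BGMW transform commutes with marking powers**: `(𝓘^a, E, aμ)' = ((𝓘, E, μ)')^a` along a blow-up whose
exceptional ideal is effective Cartier, as soon as `σ^*𝓘 ⊆ 𝓘(D)^μ` (multiplicativity of controlled transforms).
[cite: BierstoneGrigorievMilmanWlodarczyk2011, Lemma 3.7.1] -/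
theorem powMarked_transform {X X' : Scheme.{0}} [IsLocallyNoetherian X'] (σ : X' ⟶ X) (C : X.IdealSheafData)
    (M : MarkedIdeal X) (a : ℕ) (hD : IsEffectiveCartier (C.comap σ)) (h : M.ideal.comap σ ≤ C.comap σ ^ M.mult) :
    (powMarked M a).transform σ C = powMarked (M.transform σ C) a := by
  simp only [powMarked, MarkedIdeal.transform, controlledTransform_pow hD h a]

end MarkingPower

/-! ## §2 The marking-power tower `T ↦ T^a` -/

section PowerTower

/-- **THE MARKING-POWER TOWER `T^a`**: the forced tower with the SAME stages, marked points, centres, blow-ups and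
boundaries as `T` and the marked ideals `(𝓘_i^a, E_i, a·n)`.  The two tower axioms that read the marking — isolation of the
marked point in the support, and the transform law — are the arguments `hiso`, `htr`, discharged for towers with a base root
by `powTower_hiso`, `powTower_htr`. -/
def powTower (T : ForcedTower) (a : ℕ)
    (hiso : ∀ i, IsIsolatedIn (powMarked (T.D i) a).support (T.pt i))
    (htr : ∀ i, powMarked (T.D (i + 1)) a = (powMarked (T.D i) a).transform (T.π i) (T.centre i)) :
    ForcedTower where
  St := T.St
  D i := powMarked (T.D i) a
  pt := T.pt
  centre := T.centre
  π := T.π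
  isolated := hiso
  isClosed_pt := T.isClosed_pt
  centre_support := T.centre_support
  centre_regular := T.centre_regular
  isBlowup := T.isBlowup
  transform_eq := htr
  pt_map := T.pt_map

variable {k : Type} [Field k]

/-- **ISOLATION PERSISTS** (`supp(𝓘_i^a, a·n) = supp(𝓘_i, n)` on the regular stage `X_i`).
[cite: BierstoneGrigorievMilmanWlodarczyk2011, Example 3.4.2] -/
theorem powTower_hiso (T : ForcedTower) (g : T.St 0 ⟶ Spec (.of k)) (hB : IsBase (T.St 0) g) {a : ℕ} (ha : 0 < a) :
    ∀ i, IsIsolatedIn (powMarked (T.D i) a).support (T.pt i) := by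
  intro i
  have hreg := tower_isRegular T g hB i
  obtain ⟨hmem, U, hxU, hU⟩ := T.isolated i
  haveI := hreg (T.pt i)
  refine ⟨(mem_support_powMarked_iff (T.D i) ha (T.pt i)).mpr hmem, U, hxU, fun y hy => ?_⟩
  haveI := hreg y
  exact hU ⟨hy.1, (mem_support_powMarked_iff (T.D i) ha y).mp hy.2⟩

/-- **THE TRANSFORM LAW PERSISTS**: `(𝓘_{i+1}^a, a·n) = ((𝓘_i^a, a·n))'` — multiplicativity of the controlled transform, the
divisibility `𝓘_i ⊆ 𝓘_{x_i}^n` being order-permissibility of the point centre on the regular stage (`ord_{x_i} 𝓘_i = n`).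
[cite: BierstoneGrigorievMilmanWlodarczyk2011, Lemma 3.7.1, Lemma 3.2.1] -/
theorem powTower_htr (T : ForcedTower) (g : T.St 0 ⟶ Spec (.of k)) (hB : IsBase (T.St 0) g) {n : ℕ}
    (hD : IsDatum n (T.D 0)) (a : ℕ) :
    ∀ i, powMarked (T.D (i + 1)) a = (powMarked (T.D i) a).transform (T.π i) (T.centre i) := by
  intro i
  obtain ⟨hNi, hRi⟩ := tower_isLocallyNoetherian_isRegular T g hB i
  haveI := hNi
  haveI : IsLocallyNoetherian (T.St (i + 1)) := (tower_isLocallyNoetherian_isRegular T g hB (i + 1)).1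
  have hle : (T.D i).ideal ≤ T.centre i ^ (T.D i).mult := by
    refine le_pow_of_isRegular_subscheme_of_forall_le_idealOrder_of_isRegular hRi (T.centre_regular i) ?_
    intro y hy
    have hy' : y ∈ ((T.centre i).support : Set (T.St i)) := hy
    rw [T.centre_support i, Set.mem_singleton_iff] at hy'
    rw [hy', tower_idealOrder_pt_eq T g hB hD i, tower_mult_eq T hD i]
  rw [T.transform_eq i]
  exact (powMarked_transform (T.π i) (T.centre i) (T.D i) a (T.isBlowup i).isEffectiveCartier
    (comap_le_comap_pow_of_le_pow hle (T.π i))).symm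

/-- **THE ROOT DATUM TRANSPORTS with weight `a·n`** (`ord_y 𝓘^a = a · ord_y 𝓘 ≤ a·n` at the regular points of the base).
[cite: ZariskiSamuel1960, Ch. VIII §1 Thm. 1] -/
theorem powTower_isDatum (T : ForcedTower) (g : T.St 0 ⟶ Spec (.of k)) (hB : IsBase (T.St 0) g) {n : ℕ}
    (hD : IsDatum n (T.D 0)) (a : ℕ) (hiso : ∀ i, IsIsolatedIn (powMarked (T.D i) a).support (T.pt i))
    (htr : ∀ i, powMarked (T.D (i + 1)) a = (powMarked (T.D i) a).transform (T.π i) (T.centre i)) :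
    IsDatum (a * n) ((powTower T a hiso htr).D 0) := by
  refine ⟨?_, fun y => ?_⟩
  · show a * (T.D 0).mult = a * n
    rw [hD.1]
  · show idealOrder ((T.D 0).ideal ^ a) y ≤ ((a * n : ℕ) : ℕ∞)
    haveI := hB.isRegular y
    have hfin : idealOrder (T.D 0).ideal y ≠ ⊤ := ne_top_of_le_ne_top (ENat.coe_ne_top n) (hD.2 y)
    obtain ⟨b, hb⟩ := ENat.ne_top_iff_exists.mp hfin
    rw [idealOrder_pow_eq (T.D 0).ideal hb.symm a]
    have hbn : b ≤ n := by
      have := hD.2 y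
      rw [← hb] at this
      exact_mod_cast this
    exact_mod_cast Nat.mul_le_mul_left a hbn

end PowerTower

end Summit.ResolutionOfSingularities.ResolutionOfSingularities.Theorems.HugValuationCut
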